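import Summits.HodgeConjecture.CorCM.IrreducibleOddWeightsMultiplicityFamilies
import Summits.HodgeConjecture.CorCM.IrreducibleOddWeightsMultiplicityTransitive
import Literature.NumberTheory.ComplexMultiplication.CMTypeRankMultiplicityOne
import HarnessLib

/-!
# Multiplicities are monotone in the cyclic module; a CM type on a transitive slot is nondegenerate iff
# `dim A_Φ V^H = dim (1 − π(s ρx₀)) V^H` for every irreducible `π` (Mai's invertibility criterion for NON-GALOIS fields)

COR-CM (cell `pub-hodgecm2`, binder seat `b16` gen 57, count-neutral claim MULTIPLICITY, file F8 — sequel of F4/F5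
`CorCM/IrreducibleOddWeightsMultiplicity{Families,Transitive}` (local notation `𝒪[G, w]` orbit span, `Ev[G, π, w]`
evaluation space); theorems only, no definition, no named fact, no `sorry`).  NEW as stated, hence under `Summits/`.
HONEST FRAMING: a decidable nondegeneracy criterion "for NAMED configurations" (kernel, unconditional) for INT-4 «what
is known» — nondegenerate CM type = `dim Hg(A_Φ) = dim A_Φ`; `HC_CM` is neither used nor asserted.

* §1 **`finrank_evalSpace_eq_of_orbitSpan_eq`** — `dim Ev[G, π, u]` depends only on the cyclic module `𝒪[G, u]`
  (evaluation `Hom_G(ℚ^X, V) → V` at a generator has kernel `{T : T|_{𝒪} = 0}`); **`finrank_evalSpace_mono`** —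
  `𝒪[G, v] ≤ 𝒪[G, w] ⟹ dim Ev[G, π, v] ≤ dim Ev[G, π, w]` (multiplicities are monotone; via the splitting step F2).
* §2 **`finrank_orbitSpan_eq_iff_forall`** — for `𝒪[G, v] ≤ 𝒪[G, w]` and irreducibles covering `𝒪[G, w]`:
  `dim 𝒪[G, v] = dim 𝒪[G, w] ⟺ dim Ev[G, π_k, v] = dim Ev[G, π_k, w]` for every `k` (weighted sums of monotone terms).
* §3 A CM SLOT: `X` transitive (`x₀`, section `s`, `H = Stab(x₀)`) with a conjugation `ρ ∈ G` (`IsCMTypeWith ρ Φ`):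
  **`antiWeights_eq_orbitSpan`** (the odd weights are the cyclic module of `δ_{x₀} − δ_{ρx₀}`),
  **`typeRank_eq_iff_forall_finrank_map_eq`** — **`Φ` is NONDEGENERATE iff for every irreducible `π_k` covering the odd
  weights, `dim A_{Φ,k}(V_k^H) = dim B_k(V_k^H)`**, `A_{Φ,k} = Σ_x u_1(Φ)(x) π_k(s x)`, `B_k = Σ_x (δ_{x₀} − δ_{ρx₀})(x)
  π_k(s x)` (`= π_k(s x₀) − π_k(s(ρx₀))`) — Mai's "nondegenerate ⟺ `π(τ)` invertible for every odd irreducible `π`"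
  (`K` Galois, tree `Literature/…/CMTypeRankRegularRepresentation`) for an ARBITRARY CM field, over `ℚ`: on the
  `H`-invariants the operator `A_Φ` must lose no more rank than the antisymmetriser `B`.

Sequel: F9 `CorCM/IrreducibleOddWeightsMultiplicityCriterionCMFields` (families and CM fields).

## References

* [Mai1989] L. Mai, *Lower bounds for the ranks of CM types*, J. Number Theory 32 (1989), §2 Prop. 1 and the criterion
  following it.
* [Kubota1965] T. Kubota, *On the field extension by complex multiplication*, Trans. AMS 118 (1965), Lemma 2.
* [Serre1977] J.-P. Serre, *Linear Representations of Finite Groups*, GTM 42 (1977), §1.3 Thm. 1, §3.3.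
* [Gordon1999HodgeAVSurvey] B. B. Gordon, *A survey of the Hodge conjecture for abelian varieties*, 9.4.
-/

set_option autoImplicit false

noncomputable section

open scoped BigOperators

universe u u' v w

namespace Summit.HodgeConjecture.CorCM.IrrOdd

open Literature.NumberTheory.ComplexMultiplication

variable {G : Type w} [Group G]

/-- The orbit span `𝒪[G, w] = span_ℚ {x ↦ w (g • x) : g ∈ G}` (local notation, no definition). -/
local notation3 (prettyPrint := false) "𝒪[" G' ", " w "]" =>
  Submodule.span ℚ (Set.range fun g : G' => fun x => w (g • x))

/-- The evaluation space `Ev[G, π, w] = {T w : T equivariant}` (local notation, no definition). -/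
local notation3 (prettyPrint := false) "Ev[" G' ", " π ", " w "]" =>
  Submodule.span ℚ {v | ∃ T : (_ → ℚ) →ₗ[ℚ] _,
    (∀ (g : G') (f : _ → ℚ), T (fun x => f (g⁻¹ • x)) = π g (T f)) ∧ T w = v}

variable {X : Type v} [MulAction G X] [Fintype X] {V : Type*} [AddCommGroup V] [Module ℚ V] [FiniteDimensional ℚ V]

/-! ### §1 `dim Ev` is an invariant of the cyclic module, monotone under inclusion -/

section Monotone

/-- **`dim Ev[G, π, u]` depends only on `𝒪[G, u]`**: evaluation at `u` on the space of equivariant maps `ℚ^X → V`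
has image `Ev[G, π, u]` and kernel the maps killing `𝒪[G, u]`. [cite: Serre1977, §1.3] [cite: Mai1989, §2 Prop. 1 (proof)] -/
theorem finrank_evalSpace_eq_of_orbitSpan_eq (π : Representation ℚ G V) {u u' : X → ℚ} (h : 𝒪[G, u] = 𝒪[G, u']) :
    Module.finrank ℚ Ev[G, π, u] = Module.finrank ℚ Ev[G, π, u'] := by
  -- the space of equivariant maps
  let Hm : Submodule ℚ ((X → ℚ) →ₗ[ℚ] V) :=
    Submodule.span ℚ {T | ∀ (g : G) (f : X → ℚ), T (fun x => f (g⁻¹ • x)) = π g (T f)}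
  have hHm : ∀ T ∈ Hm, ∀ (g : G) (f : X → ℚ), T (fun x => f (g⁻¹ • x)) = π g (T f) := by
    intro T hT
    refine Submodule.span_induction (fun _ h => h) (fun g f => by simp) (fun a b _ _ ha hb g f => ?_)
      (fun c a _ ha g f => ?_) hT
    · rw [LinearMap.add_apply, LinearMap.add_apply, ha, hb, map_add]
    · rw [LinearMap.smul_apply, LinearMap.smul_apply, ha, map_smul]
  -- evaluation at a vector, its range and kernel
  have hrange : ∀ w : X → ℚ, LinearMap.range (LinearMap.applyₗ w ∘ₗ Hm.subtype) = Ev[G, π, w] := fun w => by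
    rw [LinearMap.range_comp, Submodule.range_subtype, Submodule.map_span]
    rfl
  have hker : LinearMap.ker (LinearMap.applyₗ u ∘ₗ Hm.subtype) = LinearMap.ker (LinearMap.applyₗ u' ∘ₗ Hm.subtype) := by
    ext ⟨T, hT⟩
    simp only [LinearMap.mem_ker, LinearMap.comp_apply, Submodule.subtype_apply, LinearMap.applyₗ_apply_apply]
    constructor
    · intro h0
      exact apply_eq_zero_of_mem_orbitSpan π T (hHm T hT) h0 (h ▸ mem_orbitSpan_self (G := G) u')
    · intro h0
      exact apply_eq_zero_of_mem_orbitSpan π T (hHm T hT) h0 (h.symm ▸ mem_orbitSpan_self (G := G) u)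
  have h1 := LinearMap.finrank_range_add_finrank_ker (LinearMap.applyₗ u ∘ₗ Hm.subtype)
  have h2 := LinearMap.finrank_range_add_finrank_ker (LinearMap.applyₗ u' ∘ₗ Hm.subtype)
  rw [hrange] at h1 h2
  rw [hker] at h1
  omega

/-- **Multiplicities are monotone**: `𝒪[G, v] ≤ 𝒪[G, w] ⟹ dim Ev[G, π, v] ≤ dim Ev[G, π, w]` (split `𝒪[G, w]` along
the equivariant projection onto `𝒪[G, v]`, F2). [cite: Serre1977, §1.3 Thm. 1] [cite: Mai1989, §2 Prop. 1 (proof)] -/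
theorem finrank_evalSpace_mono (π : Representation ℚ G V) {v w : X → ℚ} (h : 𝒪[G, v] ≤ 𝒪[G, w]) :
    Module.finrank ℚ Ev[G, π, v] ≤ Module.finrank ℚ Ev[G, π, w] := by
  obtain ⟨Q, hQ, hQP, hQid⟩ := exists_equivariant_projection (G := G) 𝒪[G, v] (orbitSpan_stable v)
  have hP : 𝒪[G, Q w] = 𝒪[G, v] := orbitSpan_proj_eq (orbitSpan_stable v) Q hQ hQP hQid h
  rw [← finrank_evalSpace_eq_of_orbitSpan_eq π hP, finrank_evalSpace_eq_add π Q hQ hQP hQid h]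
  exact Nat.le_add_right _ _

end Monotone

/-! ### §2 Equal dimension of nested cyclic modules ⟺ equal multiplicities termwise -/

section Termwise

variable {K : Type u'} [Fintype K] {W : K → Type*} [∀ k, AddCommGroup (W k)] [∀ k, Module ℚ (W k)]
  [∀ k, FiniteDimensional ℚ (W k)]

omit [Fintype X] [AddCommGroup V] [Module ℚ V] [FiniteDimensional ℚ V] [MulAction G X] in
/-- Weighted sums of termwise-comparable multiples agree only termwise (`d_k > 0`, `δ_k ∣ a_k, b_k`, `a_k ≤ b_k`). [folklore] -/
theorem forall_eq_of_sum_mul_div_eq {a b d δ : K → ℕ} (hd : ∀ k, 0 < d k) (ha : ∀ k, δ k ∣ a k) (hb : ∀ k, δ k ∣ b k) (hle : ∀ k, a k ≤ b k)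
    (hsum : ∑ k, d k * (a k / δ k) = ∑ k, d k * (b k / δ k)) : ∀ k, a k = b k := by
  have hle' : ∀ k ∈ (Finset.univ : Finset K), d k * (a k / δ k) ≤ d k * (b k / δ k) := fun k _ =>
    Nat.mul_le_mul_left _ (Nat.div_le_div_right (hle k))
  intro k
  have hk := (Finset.sum_eq_sum_iff_of_le hle').1 hsum k (Finset.mem_univ k)
  have hq : a k / δ k = b k / δ k := Nat.eq_of_mul_eq_mul_left (hd k) hk
  rw [← Nat.div_mul_cancel (ha k), ← Nat.div_mul_cancel (hb k), hq]

/-- **`dim 𝒪[G, v] = dim 𝒪[G, w]` ⟺ `dim Ev[G, π_k, v] = dim Ev[G, π_k, w]` for every `k`**, when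
`𝒪[G, v] ≤ 𝒪[G, w]` and the pairwise non-isomorphic irreducibles `π_k` cover `𝒪[G, w]`.
[cite: Mai1989, §2 Prop. 1 (proof)] [cite: Serre1977, §2.2 Prop. 4] -/
theorem finrank_orbitSpan_eq_iff_forall {v w : X → ℚ} (hvw : 𝒪[G, v] ≤ 𝒪[G, w])
    (π : ∀ k, Representation ℚ G (W k)) (hirr : ∀ k, (π k).IsIrreducible)
    (hne : ∀ k l, k ≠ l → ∀ S : (π k).IntertwiningMap (π l), S = 0)
    (hcov : ∀ P : Submodule ℚ (X → ℚ), P ≤ 𝒪[G, w] → P ≠ ⊥ →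
      (∀ (g : G) (f : X → ℚ), f ∈ P → (fun x => f (g • x)) ∈ P) →
      ∃ k, ∃ T : (X → ℚ) →ₗ[ℚ] W k,
        (∀ (g : G) (f : X → ℚ), T (fun x => f (g⁻¹ • x)) = π k g (T f)) ∧ ∃ f ∈ P, T f ≠ 0) :
    Module.finrank ℚ 𝒪[G, v] = Module.finrank ℚ 𝒪[G, w] ↔
      ∀ k, Module.finrank ℚ Ev[G, π k, v] = Module.finrank ℚ Ev[G, π k, w] := by
  obtain ⟨hdw, hw⟩ := finrank_orbitSpan_eq_sum w π hirr hne hcov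
  obtain ⟨hdv, hv⟩ := finrank_orbitSpan_eq_sum v π hirr hne
    (cover_of_le (hvw (mem_orbitSpan_self v)) (orbitSpan_stable w) π hcov)
  constructor
  · intro h
    rw [hv, hw] at h
    exact forall_eq_of_sum_mul_div_eq (fun k => finrank_pos_of_isIrreducible (π k) (hirr k)) hdv hdw
      (fun k => finrank_evalSpace_mono (π k) hvw) h
  · intro h
    rw [hv, hw]
    exact Finset.sum_congr rfl fun k _ => by rw [h k]

end Termwise

/-! ### §3 A CM slot: the odd weights as a cyclic module, and the nondegeneracy criterion -/

section CMSlot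

variable [DecidableEq X]

omit [Fintype X] in
/-- `δ_{x₀}(ρx) = δ_{ρx₀}(x)` for an involution `ρ` of `X`. [folklore] -/
theorem single_apply_rho_smul {ρ : G} (hinv : ∀ x : X, ρ • ρ • x = x) (x₀ x : X) :
    (Pi.single x₀ (1 : ℚ) : X → ℚ) (ρ • x) = (Pi.single (ρ • x₀) (1 : ℚ) : X → ℚ) x := by
  by_cases hx : x = ρ • x₀
  · subst hx; simp [hinv]
  · have hx' : ρ • x ≠ x₀ := fun h' => hx (by rw [← h', hinv])
    rw [Pi.single_eq_of_ne hx', Pi.single_eq_of_ne hx]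

/-- **The odd weights are the cyclic module of `δ_{x₀} − δ_{ρx₀}`** on a transitive slot with a conjugation `ρ`
commuting with `G` (every `δ_x − δ_{ρx}` is a translate, and `f = ½ Σ_x f(x) (δ_x − δ_{ρx})` for odd `f`).
[cite: Kubota1965, §2 (p. 115)] [cite: Shimura1998, §32.10] -/
theorem antiWeights_eq_orbitSpan {ρ : G} {Φ : Set X} (h : IsCMTypeWith ρ Φ) {x₀ : X} {s : X → G}
    (hs : ∀ x, s x • x₀ = x) :
    antiWeights (E := X) ρ = 𝒪[G, fun y => (Pi.single x₀ (1 : ℚ) : X → ℚ) y - (Pi.single (ρ • x₀) (1 : ℚ) : X → ℚ) y] := by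
  have hinv : ∀ x : X, ρ • ρ • x = x := h.invol
  -- the translates are the `δ_x − δ_{ρx}`
  have htr : ∀ x : X, (fun y => (fun y => (Pi.single x₀ (1 : ℚ) : X → ℚ) y -
      (Pi.single (ρ • x₀) (1 : ℚ) : X → ℚ) y) ((s x)⁻¹ • y)) =
      fun y => (Pi.single x (1 : ℚ) : X → ℚ) y - (Pi.single (ρ • x) (1 : ℚ) : X → ℚ) y := fun x => by
    have h1 := comp_smul_single (G := G) x₀ (s x)
    have h2 := comp_smul_single (G := G) (ρ • x₀) (s x)
    funext y
    have e1 : (Pi.single x₀ (1 : ℚ) : X → ℚ) ((s x)⁻¹ • y) = (Pi.single (s x • x₀) (1 : ℚ) : X → ℚ) y :=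
      congrFun h1 y
    have e2 : (Pi.single (ρ • x₀) (1 : ℚ) : X → ℚ) ((s x)⁻¹ • y) =
        (Pi.single (s x • ρ • x₀) (1 : ℚ) : X → ℚ) y := congrFun h2 y
    show (Pi.single x₀ (1 : ℚ) : X → ℚ) ((s x)⁻¹ • y) - (Pi.single (ρ • x₀) (1 : ℚ) : X → ℚ) ((s x)⁻¹ • y) =
      (Pi.single x (1 : ℚ) : X → ℚ) y - (Pi.single (ρ • x) (1 : ℚ) : X → ℚ) y
    rw [e1, e2, hs x, h.comm, hs x]
  apply le_antisymm
  · intro f hf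
    have hodd : ∀ x, f (ρ • x) = -f x := fun x => hf x
    -- `f = ½ Σ_x f(x) (δ_x − δ_{ρx})`
    have hs1 : ∀ y, ∑ x, f x / 2 * (Pi.single x (1 : ℚ) : X → ℚ) y = f y / 2 := fun y => by
      rw [Finset.sum_eq_single y (fun b _ hb => by rw [Pi.single_eq_of_ne (Ne.symm hb), mul_zero])
        (fun hy => (hy (Finset.mem_univ y)).elim), Pi.single_eq_same, mul_one]
    have hs2 : ∀ y, ∑ x, f x / 2 * (Pi.single (ρ • x) (1 : ℚ) : X → ℚ) y = f (ρ • y) / 2 := fun y => by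
      rw [Finset.sum_eq_single (ρ • y) (fun b _ hb => ?_) (fun hy => (hy (Finset.mem_univ _)).elim), hinv,
        Pi.single_eq_same, mul_one]
      have hne : y ≠ ρ • b := fun h' => hb (by rw [h', hinv])
      rw [Pi.single_eq_of_ne hne, mul_zero]
    have hrep : f = ∑ x, (f x / 2) •
        fun y => (Pi.single x (1 : ℚ) : X → ℚ) y - (Pi.single (ρ • x) (1 : ℚ) : X → ℚ) y := by
      funext y
      rw [Finset.sum_apply]
      simp only [Pi.smul_apply, smul_eq_mul, mul_sub, Finset.sum_sub_distrib, hs1, hs2, hodd]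
      ring
    rw [hrep]
    exact Submodule.sum_mem _ fun x _ => Submodule.smul_mem _ _ (Submodule.subset_span ⟨(s x)⁻¹, htr x⟩)
  · have ha : (fun y => (Pi.single x₀ (1 : ℚ) : X → ℚ) y - (Pi.single (ρ • x₀) (1 : ℚ) : X → ℚ) y) ∈
        antiWeights (E := X) ρ := by
      intro x
      show (Pi.single x₀ (1 : ℚ) : X → ℚ) (ρ • x) - (Pi.single (ρ • x₀) (1 : ℚ) : X → ℚ) (ρ • x) =
        -((Pi.single x₀ (1 : ℚ) : X → ℚ) x - (Pi.single (ρ • x₀) (1 : ℚ) : X → ℚ) x)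
      rw [single_apply_rho_smul hinv, single_apply_rho_smul hinv, hinv, neg_sub]
    exact orbitSpan_le (w := fun y => (Pi.single x₀ (1 : ℚ) : X → ℚ) y - (Pi.single (ρ • x₀) (1 : ℚ) : X → ℚ) y) (comp_smul_mem_antiWeights h.comm) ha

omit [FiniteDimensional ℚ V] in
/-- `B = Σ_x (δ_{x₀} − δ_{ρx₀})(x) π(s x) = π(s x₀) − π(s(ρx₀))`. [folklore] -/
theorem sum_sub_single_smul_eq (π : Representation ℚ G V) (ρ : G) (x₀ : X) (s : X → G) :
    ∑ x, ((Pi.single x₀ (1 : ℚ) : X → ℚ) x - (Pi.single (ρ • x₀) (1 : ℚ) : X → ℚ) x) • π (s x) =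
      π (s x₀) - π (s (ρ • x₀)) := by
  simp only [sub_smul, Finset.sum_sub_distrib]
  rw [Finset.sum_eq_single x₀ (fun x _ hx => by rw [Pi.single_eq_of_ne hx, zero_smul])
      (fun hx => (hx (Finset.mem_univ _)).elim),
    Finset.sum_eq_single (ρ • x₀) (fun x _ hx => by rw [Pi.single_eq_of_ne hx, zero_smul])
      (fun hx => (hx (Finset.mem_univ _)).elim)]
  simp only [Pi.single_eq_same, one_smul]

variable {K : Type u'} [Fintype K] {W : K → Type*} [∀ k, AddCommGroup (W k)] [∀ k, Module ℚ (W k)]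
  [∀ k, FiniteDimensional ℚ (W k)]

/-- **NONDEGENERACY CRITERION ON A TRANSITIVE CM SLOT.**  `X` a transitive `G`-set (`x₀`, section `s`,
`H = Stab(x₀)`), `ρ ∈ G` a conjugation (`IsCMTypeWith ρ Φ`), `(π_k, V_k)` pairwise non-isomorphic irreducibles
covering the odd weights.  Then **`rank(Φ) = |X|/2 + 1` (nondegenerate) iff for every `k`,
`dim A_{Φ,k}(V_k^H) = dim B_k(V_k^H)`**, where `A_{Φ,k} = Σ_x u_1(Φ)(x) π_k(s x)` and
`B_k = Σ_x (δ_{x₀} − δ_{ρx₀})(x) π_k(s x) = π_k(s x₀) − π_k(s(ρx₀))` act on the `H`-invariants — Mai's criterion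
"nondegenerate ⟺ `π(τ)` invertible for every odd irreducible `π`" for an ARBITRARY (non-Galois) field, over `ℚ`.
[cite: Mai1989, §2 Prop. 1] [cite: Kubota1965, Lemma 2] [cite: Gordon1999HodgeAVSurvey, 9.4] -/
theorem typeRank_eq_iff_forall_finrank_map_eq {ρ : G} {Φ : Set X} (h : IsCMTypeWith ρ Φ) {x₀ : X} {s : X → G}
    (hs : ∀ x, s x • x₀ = x) (π : ∀ k, Representation ℚ G (W k)) (hirr : ∀ k, (π k).IsIrreducible)
    (hne : ∀ k l, k ≠ l → ∀ S : (π k).IntertwiningMap (π l), S = 0)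
    (hcov : ∀ P : Submodule ℚ (X → ℚ), P ≤ antiWeights (E := X) ρ → P ≠ ⊥ →
      (∀ (g : G) (f : X → ℚ), f ∈ P → (fun x => f (g • x)) ∈ P) →
      ∃ k, ∃ T : (X → ℚ) →ₗ[ℚ] W k,
        (∀ (g : G) (f : X → ℚ), T (fun x => f (g⁻¹ • x)) = π k g (T f)) ∧ ∃ f ∈ P, T f ≠ 0) :
    typeRank G Φ = Fintype.card X / 2 + 1 ↔
      ∀ k, Module.finrank ℚ ((Representation.invariants ((π k).comp (MulAction.stabilizer G x₀).subtype)).map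
          (∑ x, antiVec Φ (1 : G) x • π k (s x))) =
        Module.finrank ℚ ((Representation.invariants ((π k).comp (MulAction.stabilizer G x₀).subtype)).map
          (∑ x, ((Pi.single x₀ (1 : ℚ) : X → ℚ) x - (Pi.single (ρ • x₀) (1 : ℚ) : X → ℚ) x) • π k (s x))) := by
  haveI : Nonempty X := ⟨x₀⟩
  have hanti := antiWeights_eq_orbitSpan h hs
  have hU : 𝒪[G, antiVec Φ (1 : G)] = antiSpan G Φ := orbitSpan_antiVec_one Φ
  have hle : 𝒪[G, antiVec Φ (1 : G)] ≤
      𝒪[G, fun y => (Pi.single x₀ (1 : ℚ) : X → ℚ) y - (Pi.single (ρ • x₀) (1 : ℚ) : X → ℚ) y] := by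
    rw [hU, ← hanti]
    exact antiSpan_le_antiWeights' h
  rw [hanti] at hcov
  rw [h.typeRank_eq_iff_antiSpan_eq]
  -- `antiSpan = antiWeights ⟺ equal dimensions ⟺ termwise`
  have hdim : antiSpan G Φ = antiWeights (E := X) ρ ↔
      Module.finrank ℚ 𝒪[G, antiVec Φ (1 : G)] =
        Module.finrank ℚ 𝒪[G, fun y => (Pi.single x₀ (1 : ℚ) : X → ℚ) y - (Pi.single (ρ • x₀) (1 : ℚ) : X → ℚ) y] := by
    rw [hU, ← hanti]
    exact ⟨fun heq => by rw [heq], fun heq => Submodule.eq_of_le_of_finrank_eq (antiSpan_le_antiWeights' h) heq⟩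
  rw [hdim, finrank_orbitSpan_eq_iff_forall (v := antiVec Φ (1 : G)) (w := fun y => (Pi.single x₀ (1 : ℚ) : X → ℚ) y - (Pi.single (ρ • x₀) (1 : ℚ) : X → ℚ) y) hle π hirr hne hcov]
  refine forall_congr' fun k => ?_
  rw [finrank_evalSpace_eq_finrank_map (π k) hs, finrank_evalSpace_eq_finrank_map (π k) hs]

end CMSlot

end Summit.HodgeConjecture.CorCM.IrrOdd

end
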